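import Summits.CriticalPhenomena.Ising3DConformalLimit.Theorems.MonotoneBlockingMonotoneBlockingTwoFourFunctions
import Summits.CriticalPhenomena.Ising3DConformalLimit.Theorems.MonotoneBlockingMonotoneBlockingTwoFoldedTentTP2
import Summits.CriticalPhenomena.Ising3DConformalLimit.Theorems.MonotoneBlockingMonotoneBlockingTwoFoldedBlockIntegralTP2
import Summits.CriticalPhenomena.Ising3DConformalLimit.Theorems.MonotoneBlockingMonotoneBlockingTwoConvolution1D
import Summits.CriticalPhenomena.Ising3DConformalLimit.Theorems.MonotoneBlockingMonotoneBlockingTwoBlockSumCellSmear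
import Summits.CriticalPhenomena.Ising3DConformalLimit.Theorems.MonotoneBlockingMonotoneBlockingTwoFold
import HarnessLib

/-!
# `KarlinComposition` — scale-totally-positive kernels have monotone blocking (line `Sketch`, crux `MonotoneBlockingTwo`)

Route `MonotoneBlocking`, sub-problem `CriticalPhenomena/Ising3DConformalLimit`, crux BM₂ =
`Summit.CriticalPhenomena.Ising3DConformalLimit.Theses.MonotoneBlocking.MonotoneBlockingTwo` (stmt-CriticalPhenomena-17054),
line `Sketch` (idea card `Cruxes/MonotoneBlockingTwo/Ideas/karlin-scale-tp2.md`, skeleton `Cruxes/MonotoneBlockingTwo/Lines/Sketch.lean`).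

This file CLOSES the provable half of the line: **`karlinComposition : KarlinComposition`** — for every continuum kernel
`Γ` of the scale-total-positivity class `KarlinClass` (measurable, non-negative, even in each coordinate,
`(L,s) ↦ Γ(L s)` multivariate-TP₂ on `(0,∞)⁴`, `Γ(y) ≤ λ³Γ(λy)`, finite cell averages) and every nugget `N ≥ 0`, the
lattice kernel `G = Γ⋆T + N·𝟙₀` has the BM₂ shape: `bc_G(L,k)·bc_G(L+1,0) ≤ bc_G(L+1,k)·bc_G(L,0)` for all `L ≥ 1`, all
`k ∈ ℤ³` (block-covariance ratios `ρ_G(L;k)` non-decreasing in the block side). It is assembled from the six landed stubs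
of the skeleton — `stub_fourFunctions` (continuous four-functions theorem on a chain, p159242), `stub_foldedTent_tp2`
(p159414), `stub_foldedBlockIntegral_tp2` (MTP₂ of the folded scaled block integral, p160124), `stub_convolution1D`
(p159818), `stub_blockSum_cellSmear` (exact continuum embedding of the block sum, p159844), `stub_fold` (p159633) — by
the lead's glue: the nugget column `bc_{𝟙₀}(L,k) = L³𝟙_{k=0}`, finiteness and the `ℝ≥0∞ → ℝ` bookkeeping, the TP₂
comparison `(L,|k|) ∧ (L+1,0) = (L,0)`, `(L,|k|) ∨ (L+1,0) = (L+1,|k|)`, and the cubic column.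

Consequence recorded here (conditional, by name): `monotoneBlockingTwo_of_criticalKarlinRepresentable :
CriticalKarlinRepresentable → MonotoneBlockingTwo` — the crux BM₂ holds as soon as the critical two-point function of
the n.n. Ising model on `ℤ³` is the cell-smearing of a class kernel plus a non-negative nugget (the line's transfer,
registered stub `stub_criticalKarlinRepresentable`, OPEN: it is not derivable from the tree's qualitative knowledge of
`criticalTwoPoint 3`).

Sources: S. Karlin, *Total Positivity* I (1968) ch. 3 (basic composition formula); S. Karlin, Y. Rinott, J. Multivariate
Anal. 10 (1980) 467–498 (MTP₂, four-function form, marginals); idea card `karlin-scale-tp2` (this crux).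
-/

noncomputable section

namespace Summit.CriticalPhenomena.Ising3DConformalLimit.Cruxes.MonotoneBlockingTwo.KarlinScaleTP2

open MeasureTheory Set
open scoped BigOperators ENNReal
open Literature.Probability.LatticeModels
open Summit.CriticalPhenomena.Ising3DConformalLimit.Theses.MonotoneBlocking (MonotoneBlockingTwo)

/-! ## Glue (lead): cube facts, the nugget column, finiteness and `ℝ≥0∞ → ℝ` bookkeeping, the cubic column -/

/-- Membership in the cube, coordinatewise. -/
theorem mem_cube {L : ℕ} {x : Site 3} : x ∈ cube L ↔ ∀ i, 0 ≤ x i ∧ x i < (L:ℤ) := by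
  simp [cube, Fintype.mem_piFinset, Finset.mem_Ico]

/-- `bcK` is additive in the kernel. -/
theorem bcK_add (G H : Site 3 → ℝ) (L : ℕ) (k : Site 3) :
    bcK (fun z => G z + H z) L k = bcK G L k + bcK H L k := by
  simp [bcK, Finset.sum_add_distrib]

/-- `bcK` is homogeneous in the kernel. -/
theorem bcK_const_mul (c : ℝ) (G : Site 3 → ℝ) (L : ℕ) (k : Site 3) :
    bcK (fun z => c * G z) L k = c * bcK G L k := by
  simp [bcK, Finset.mul_sum]

/-- In the cube, a lattice vector `L•k + x − y` vanishes only if `k = 0` (coordinates of `x − y` are `< L` in size). -/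
theorem eq_zero_of_smul_add_sub_eq_zero {L : ℕ} (hL : 1 ≤ L) {k x y : Site 3} (hx : x ∈ cube L)
    (hy : y ∈ cube L) (h : (L:ℤ) • k + x - y = 0) : k = 0 := by
  funext i
  have hi := congrFun h i
  simp only [Pi.add_apply, Pi.sub_apply, Pi.smul_apply, Pi.zero_apply, smul_eq_mul] at hi
  obtain ⟨hx0, hxL⟩ := mem_cube.mp hx i
  obtain ⟨hy0, hyL⟩ := mem_cube.mp hy i
  have hLpos : (0:ℤ) < L := by exact_mod_cast hL
  have e : (L:ℤ) * k i = y i - x i := by linarith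
  have h1 : (L:ℤ) * k i < L * 1 := by rw [e]; linarith
  have h2 : (L:ℤ) * (-1) < L * k i := by rw [e]; linarith
  have h1' := lt_of_mul_lt_mul_left h1 hLpos.le
  have h2' := lt_of_mul_lt_mul_left h2 hLpos.le
  show k i = 0
  omega

/-- **The nugget column**: `bc_{𝟙₀}(L,k) = L³ 𝟙_{k=0}` for `L ≥ 1`. -/
theorem bcK_ite_zero (L : ℕ) (hL : 1 ≤ L) (k : Site 3) :
    bcK (fun z => if z = 0 then (1:ℝ) else 0) L k = if k = 0 then ((L:ℝ) ^ 3) else 0 := by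
  unfold bcK
  by_cases hk : k = 0
  · subst hk
    simp only [smul_zero, zero_add, sub_eq_zero, if_true]
    have h1 : ∀ x ∈ cube L, ∑ y ∈ cube L, (if x = y then (1:ℝ) else 0) = 1 := fun x hx => by
      rw [Finset.sum_ite_eq]; simp [hx]
    rw [Finset.sum_congr rfl h1]
    have hcard : (cube L).card = L ^ 3 := by
      simp [cube, Fintype.card_piFinset, Int.card_Ico, Finset.prod_const, Finset.card_univ]
    simp [hcard]
  · rw [if_neg hk]
    refine Finset.sum_eq_zero fun x hx => Finset.sum_eq_zero fun y hy => ?_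
    beta_reduce
    rw [if_neg]
    exact fun h => hk (eq_zero_of_smul_add_sub_eq_zero hL hx hy h)

/-- Block covariance of the represented kernel = smeared part + nugget column. -/
theorem bcK_rep (Γ : ℝ → ℝ → ℝ → ℝ) (N : ℝ) (L : ℕ) (hL : 1 ≤ L) (k : Site 3) :
    bcK (fun z => cellSmear Γ z + if z = 0 then N else 0) L k =
      bcK (cellSmear Γ) L k + N * (if k = 0 then ((L:ℝ) ^ 3) else 0) := by
  rw [bcK_add, ← bcK_ite_zero L hL k, ← bcK_const_mul]
  congr 1
  refine congrArg (fun G => bcK G L k) (funext fun z => ?_)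
  split_ifs <;> simp

/-- Coordinatewise absolute offsets of the zero offset vanish. -/
theorem natAbs_apply_zero : (fun i => ((0 : Site 3) i).natAbs) = (0 : Fin 3 → ℕ) := by
  funext i; simp

/-- The smeared block sum is finite (class axiom `smearFinite`). -/
theorem sum_cellSmearE_lt_top {Γ : ℝ → ℝ → ℝ → ℝ} (hK : KarlinClass Γ) (L : ℕ) (k : Site 3) :
    ∑ x ∈ cube L, ∑ y ∈ cube L, cellSmearE Γ ((L:ℤ) • k + x - y) < ∞ :=
  ENNReal.sum_lt_top.mpr fun _ _ => ENNReal.sum_lt_top.mpr fun _ _ => hK.smearFinite _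

/-- The smeared block sum as a real number. -/
theorem bcK_cellSmear_eq_toReal {Γ : ℝ → ℝ → ℝ → ℝ} (hK : KarlinClass Γ) (L : ℕ) (k : Site 3) :
    bcK (cellSmear Γ) L k = (∑ x ∈ cube L, ∑ y ∈ cube L, cellSmearE Γ ((L:ℤ) • k + x - y)).toReal := by
  unfold bcK cellSmear
  rw [ENNReal.toReal_sum (fun x _ => (ENNReal.sum_lt_top.mpr fun y _ => hK.smearFinite _).ne)]
  exact Finset.sum_congr rfl fun x _ => (ENNReal.toReal_sum fun y _ => (hK.smearFinite _).ne).symm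

/-- **The continuum embedding, folded** (stubs 4, 5, 6): `Σ_{x,y} (Γ⋆T)(L•k+x−y) = L⁶ · foldedBlockIntegral Γ L |k|`. -/
theorem sum_cellSmearE_eq (h4 : Sig.stub_convolution1D) (h5 : Sig.stub_blockSum_cellSmear) (h6 : Sig.stub_fold)
    {Γ : ℝ → ℝ → ℝ → ℝ} (hK : KarlinClass Γ) {L : ℕ} (hL : 1 ≤ L) (k : Site 3) :
    ∑ x ∈ cube L, ∑ y ∈ cube L, cellSmearE Γ ((L:ℤ) • k + x - y) =
      (L:ℝ≥0∞) ^ 6 * foldedBlockIntegral Γ L (fun i => (k i).natAbs) := by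
  rw [h5 h4 Γ hK.measurable L hL k, h6 Γ hK L (Nat.cast_pos.mpr hL) k]

/-- The folded block integrals that occur are finite. -/
theorem pow_mul_foldedBlockIntegral_lt_top (h4 : Sig.stub_convolution1D) (h5 : Sig.stub_blockSum_cellSmear)
    (h6 : Sig.stub_fold) {Γ : ℝ → ℝ → ℝ → ℝ} (hK : KarlinClass Γ) {L : ℕ} (hL : 1 ≤ L) (k : Site 3) :
    (L:ℝ≥0∞) ^ 6 * foldedBlockIntegral Γ L (fun i => (k i).natAbs) < ∞ := by
  rw [← sum_cellSmearE_eq h4 h5 h6 hK hL k]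
  exact sum_cellSmearE_lt_top hK L k

/-- `bc_{Γ⋆T}(L,k)` as the real part of `L⁶ · foldedBlockIntegral Γ L |k|`. -/
theorem bcK_cellSmear_eq (h4 : Sig.stub_convolution1D) (h5 : Sig.stub_blockSum_cellSmear) (h6 : Sig.stub_fold)
    {Γ : ℝ → ℝ → ℝ → ℝ} (hK : KarlinClass Γ) {L : ℕ} (hL : 1 ≤ L) (k : Site 3) :
    bcK (cellSmear Γ) L k = ((L:ℝ≥0∞) ^ 6 * foldedBlockIntegral Γ L (fun i => (k i).natAbs)).toReal := by
  rw [bcK_cellSmear_eq_toReal hK, sum_cellSmearE_eq h4 h5 h6 hK hL k]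

/-- **The cubic column** (class axiom `cubic`): `L³ · foldedBlockIntegral Γ L n` is non-decreasing in `L > 0`. -/
theorem cubic_mono {Γ : ℝ → ℝ → ℝ → ℝ} (hK : KarlinClass Γ) {L L' : ℝ} (hL : 0 < L) (hLL' : L ≤ L')
    (n : Fin 3 → ℕ) :
    ENNReal.ofReal (L ^ 3) * foldedBlockIntegral Γ L n ≤
      ENNReal.ofReal (L' ^ 3) * foldedBlockIntegral Γ L' n := by
  have hL0 : L ≠ 0 := hL.ne'
  have hL'0 : 0 < L' := lt_of_lt_of_le hL hLL'
  unfold foldedBlockIntegral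
  rw [← lintegral_const_mul' _ _ ENNReal.ofReal_ne_top, ← lintegral_const_mul' _ _ ENNReal.ofReal_ne_top]
  refine lintegral_mono fun s₁ => ?_
  rw [mul_left_comm, mul_left_comm (ENNReal.ofReal (L' ^ 3))]
  refine mul_le_mul_right ?_ _
  rw [← lintegral_const_mul' _ _ ENNReal.ofReal_ne_top, ← lintegral_const_mul' _ _ ENNReal.ofReal_ne_top]
  refine lintegral_mono fun s₂ => ?_
  rw [mul_left_comm, mul_left_comm (ENNReal.ofReal (L' ^ 3))]
  refine mul_le_mul_right ?_ _
  rw [← lintegral_const_mul' _ _ ENNReal.ofReal_ne_top, ← lintegral_const_mul' _ _ ENNReal.ofReal_ne_top]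
  refine lintegral_mono fun s₃ => ?_
  rw [mul_left_comm, mul_left_comm (ENNReal.ofReal (L' ^ 3))]
  refine mul_le_mul_right ?_ _
  rw [← ENNReal.ofReal_mul (by positivity), ← ENNReal.ofReal_mul (by positivity)]
  apply ENNReal.ofReal_le_ofReal
  have hlam : 1 ≤ L' / L := by rwa [le_div_iff₀ hL, one_mul]
  have hc := hK.cubic (L' / L) hlam (L * s₁) (L * s₂) (L * s₃)
  have e : ∀ s, L' / L * (L * s) = L' * s := fun s => by field_simp
  rw [e, e, e] at hc
  calc L ^ 3 * Γ (L * s₁) (L * s₂) (L * s₃)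
      ≤ L ^ 3 * ((L' / L) ^ 3 * Γ (L' * s₁) (L' * s₂) (L' * s₃)) :=
        mul_le_mul_of_nonneg_left hc (by positivity)
    _ = L' ^ 3 * Γ (L' * s₁) (L' * s₂) (L' * s₃) := by field_simp

/-! ## The composition: stubs 1–6 give `KarlinComposition`; with the transfer (stub 7), the crux BY NAME -/

/-- **KarlinComposition from the six analytic stubs** (real proof: the nugget column, finiteness, the TP₂
comparison `(L,|k|) ∧ (L+1,0) = (L,0)`, `(L,|k|) ∨ (L+1,0) = (L+1,|k|)`, and the cubic column). -/
theorem karlinComposition_of (h1 : Sig.stub_fourFunctions) (h2 : Sig.stub_foldedTent_tp2)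
    (h3 : Sig.stub_foldedBlockIntegral_tp2) (h4 : Sig.stub_convolution1D) (h5 : Sig.stub_blockSum_cellSmear)
    (h6 : Sig.stub_fold) : KarlinComposition := by
  intro Γ N hK hN L hL k
  by_cases hk : k = 0
  · subst hk; exact le_of_eq (mul_comm _ _)
  have hL1 : 1 ≤ L + 1 := Nat.le_add_left 1 L
  rw [bcK_rep Γ N L hL, bcK_rep Γ N (L+1) hL1, bcK_rep Γ N (L+1) hL1, bcK_rep Γ N L hL, if_neg hk, if_neg hk,
    if_pos rfl, if_pos rfl, bcK_cellSmear_eq h4 h5 h6 hK hL, bcK_cellSmear_eq h4 h5 h6 hK hL1,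
    bcK_cellSmear_eq h4 h5 h6 hK hL1, bcK_cellSmear_eq h4 h5 h6 hK hL, natAbs_apply_zero]
  -- the four finite quantities
  set n : Fin 3 → ℕ := fun i => (k i).natAbs with hn
  have hA := pow_mul_foldedBlockIntegral_lt_top h4 h5 h6 hK hL k
  have hB := pow_mul_foldedBlockIntegral_lt_top h4 h5 h6 hK hL1 0
  have hC := pow_mul_foldedBlockIntegral_lt_top h4 h5 h6 hK hL1 k
  have hD := pow_mul_foldedBlockIntegral_lt_top h4 h5 h6 hK hL 0
  rw [natAbs_apply_zero] at hB hD
  set A := (L:ℝ≥0∞) ^ 6 * foldedBlockIntegral Γ L n with hAdef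
  set B := ((L+1:ℕ):ℝ≥0∞) ^ 6 * foldedBlockIntegral Γ ((L+1:ℕ):ℝ) 0 with hBdef
  set C := ((L+1:ℕ):ℝ≥0∞) ^ 6 * foldedBlockIntegral Γ ((L+1:ℕ):ℝ) n with hCdef
  set D := (L:ℝ≥0∞) ^ 6 * foldedBlockIntegral Γ L 0 with hDdef
  clear_value A B C D
  -- (i) the TP₂ comparison
  have hLpos : (0:ℝ) < L := Nat.cast_pos.mpr hL
  have hL1pos : (0:ℝ) < ((L+1:ℕ):ℝ) := Nat.cast_pos.mpr hL1
  have htp := h3 h1 h2 Γ hK (L:ℝ) ((L+1:ℕ):ℝ) n 0 hLpos hL1pos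
  have e1 : n ⊔ (0 : Fin 3 → ℕ) = n := by funext i; simp
  have e2 : n ⊓ (0 : Fin 3 → ℕ) = 0 := by funext i; simp
  have hle : (L:ℝ) ≤ ((L+1:ℕ):ℝ) := by exact_mod_cast Nat.le_succ L
  rw [e1, e2, max_eq_right hle, min_eq_left hle] at htp
  have hi : A * B ≤ C * D := by
    calc A * B = ((L:ℝ≥0∞) ^ 6 * ((L+1:ℕ):ℝ≥0∞) ^ 6) *
          (foldedBlockIntegral Γ L n * foldedBlockIntegral Γ ((L+1:ℕ):ℝ) 0) := by
          rw [hAdef, hBdef]; ring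
      _ ≤ ((L:ℝ≥0∞) ^ 6 * ((L+1:ℕ):ℝ≥0∞) ^ 6) *
          (foldedBlockIntegral Γ ((L+1:ℕ):ℝ) n * foldedBlockIntegral Γ L 0) := mul_le_mul_right htp _
      _ = C * D := by rw [hCdef, hDdef]; ring
  have hi' : A.toReal * B.toReal ≤ C.toReal * D.toReal := by
    rw [← ENNReal.toReal_mul, ← ENNReal.toReal_mul]
    exact ENNReal.toReal_mono (ENNReal.mul_ne_top hC.ne hD.ne) hi
  -- (ii) the cubic column
  have hcub := cubic_mono hK hLpos hle n
  have hii : ((L+1:ℕ):ℝ≥0∞) ^ 3 * A ≤ (L:ℝ≥0∞) ^ 3 * C := by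
    have eL : ENNReal.ofReal ((L:ℝ) ^ 3) = (L:ℝ≥0∞) ^ 3 := by
      rw [ENNReal.ofReal_pow (Nat.cast_nonneg L), ENNReal.ofReal_natCast]
    have eL1 : ENNReal.ofReal (((L+1:ℕ):ℝ) ^ 3) = ((L+1:ℕ):ℝ≥0∞) ^ 3 := by
      rw [ENNReal.ofReal_pow (Nat.cast_nonneg _), ENNReal.ofReal_natCast]
    rw [eL, eL1] at hcub
    calc ((L+1:ℕ):ℝ≥0∞) ^ 3 * A
        = ((L:ℝ≥0∞) ^ 3 * ((L+1:ℕ):ℝ≥0∞) ^ 3) * ((L:ℝ≥0∞) ^ 3 * foldedBlockIntegral Γ L n) := by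
          rw [hAdef]; ring
      _ ≤ ((L:ℝ≥0∞) ^ 3 * ((L+1:ℕ):ℝ≥0∞) ^ 3) *
          (((L+1:ℕ):ℝ≥0∞) ^ 3 * foldedBlockIntegral Γ ((L+1:ℕ):ℝ) n) := mul_le_mul_right hcub _
      _ = (L:ℝ≥0∞) ^ 3 * C := by rw [hCdef]; ring
  have hii' : (((L+1:ℕ):ℝ)) ^ 3 * A.toReal ≤ ((L:ℝ)) ^ 3 * C.toReal := by
    have := ENNReal.toReal_mono (ENNReal.mul_ne_top (by simp) hC.ne) hii
    rw [ENNReal.toReal_mul, ENNReal.toReal_mul, ENNReal.toReal_pow, ENNReal.toReal_pow, ENNReal.toReal_natCast,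
      ENNReal.toReal_natCast] at this
    exact this
  -- assemble
  have hii'' : N * (((L+1:ℕ):ℝ)) ^ 3 * A.toReal ≤ N * ((L:ℝ)) ^ 3 * C.toReal := by
    rw [mul_assoc, mul_assoc]; exact mul_le_mul_of_nonneg_left hii' hN
  push_cast at hi' hii'' ⊢
  nlinarith [hi', hii'']

/-- **KarlinComposition** (the provable half of line `Sketch`, kernel-checked): for `Γ ∈ 𝒦` and `N ≥ 0` the
lattice kernel `(Γ⋆T) + N·𝟙₀` has the BM₂ shape for all `L ≥ 1` and all offsets — from the six landed stubs. -/
theorem karlinComposition : KarlinComposition :=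
  karlinComposition_of stub_fourFunctions stub_foldedTent_tp2 stub_foldedBlockIntegral_tp2 stub_convolution1D
    stub_blockSum_cellSmear stub_fold

/-- **The crux modulo the transfer** (conditional result, by name): if the critical two-point function of the n.n.
Ising model on `ℤ³` is the cell-smearing of a scale-totally-positive kernel plus a non-negative nugget
(`CriticalKarlinRepresentable`, the line's open research stub), then `MonotoneBlockingTwo` (BM₂) holds. -/
theorem monotoneBlockingTwo_of_criticalKarlinRepresentable (h : CriticalKarlinRepresentable) : MonotoneBlockingTwo := by
  obtain ⟨Γ, N, hK, hN, hG⟩ := h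
  have hfun : criticalTwoPoint 3 = fun z => cellSmear Γ z + if z = 0 then N else 0 := funext hG
  rw [monotoneBlockingTwo_iff, hfun]
  exact karlinComposition Γ N hK hN

end Summit.CriticalPhenomena.Ising3DConformalLimit.Cruxes.MonotoneBlockingTwo.KarlinScaleTP2

end
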